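import Literature.Analysis.FluidPDE.AxisymmetricL3Infinity
import Literature.Analysis.FluidPDE.AxisymmetricL3OffAxis
import Literature.Analysis.FluidPDE.KNSSTypeIIHolds
import Summits.NavierStokesRegularity.NavierStokesRegularity.Theorems.CertifiedBlowupCertifiedBlowupAxisymBlowupSwirlPersists
import HarnessLib

/-!
# The blow-up set of a witness of the crux `CertifiedBlowupAxisymBlowup` is a nonempty compact
# subset of the symmetry axis

Theorems file landed `--supports stmt-NavierStokesRegularity-0727`, line `compact-amplification`
(continuation lead c2). A witness of the crux is a maximal smooth solution `(u, p)` of finite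
lifespan `T` of the unforced Navier–Stokes system (`ν > 0`), Leray–Hopf on `[0, T]` from its rapidly
decaying axisymmetric datum `u 0`. Write
`Σ = {x₀ | ¬ IsBoundedNearTop u T x₀}` for its blow-up set at the lifespan — the points `x₀` such
that `u` is unbounded on EVERY backward parabolic neighbourhood `(T - r², T) × B(x₀, r)` of
`(T, x₀)`. This file proves, from PROVED tree theorems only:

* `isBoundedNearTop_of_norm_gt` — `Σ` is bounded: `u` is bounded near `T` outside a large ball
  (`axisymmetricL3_boundedNearTop_infinity`, Lemarié-Rieusset 2016 Thm 14.4 / RRS 2016 Lemma 15.12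
  applied on the tails of the energy class);
* `isOpen_setOf_isBoundedNearTop` — `Σ` is closed (local boundedness is an open condition);
* `cylRadius_eq_zero_of_not_isBoundedNearTop` — `Σ` lies on the axis `{x' = 0}` (off-axis
  regularity at the lifespan WITHOUT a Type I hypothesis: the tree's
  `axisymmetricL3_boundedNearTop_offAxis` over `AxisymmetricL3Hyp`, Seregin–Šverák 2009 §3 /
  CKN 1982; cf. the landed `isBoundedNearTop_of_cylRadius_ne_zero`, p162528);
* `exists_not_isBoundedNearTop_of_isMaximalSmoothSolution` — `Σ ≠ ∅`: were every point of local
  boundedness, a finite subcover of the closed ball and the bound at infinity would make `u`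
  bounded on `[0, T) × ℝ³`, and bounded Leray–Hopf classical solutions continue past `T`
  (`hasSmoothExtensionPast_of_bounded_holds`, RRS 2016 Thm 8.17), contradicting maximality;
* `blowupSet_nonempty_compact_on_axis` — the registered conjunction, and
  `isCompact_blowupSet_of_isMaximalSmoothSolution`.

So every axisymmetric blow-up, if any, happens on a nonempty compact piece of the axis — exactly
where the swirl `Γ = r u_θ` vanishes; this is the normalisation problem of route `SwirlThreshold`'s
compactness crux `SwirlThresholdZoom` (stmt-2119), now a kernel-checked constraint.

No new definitions, no named-fact hypotheses, no `sorry`.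

## References

* G. Seregin, V. Šverák, Comm. PDE 34 (2009) = arXiv:0804.1803, §3 (p. 9). [SereginSverak2009]
* L. Caffarelli, R. Kohn, L. Nirenberg, Comm. Pure Appl. Math. 35 (1982). [CaffarelliKohnNirenberg1982]
* J. C. Robinson, J. L. Rodrigo, W. Sadowski, *The Three-Dimensional Navier–Stokes Equations*,
  CUP 2016, Thm. 8.17, Lemma 15.12. [RobinsonRodrigoSadowski2016]
-/

-- the summit and its single problem share the name (D-0017 nested layout)
set_option linter.dupNamespace false

noncomputable section

open MeasureTheory Set Function Filter Topology Metric
open scoped ENNReal NNReal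

namespace Summit.NavierStokesRegularity.NavierStokesRegularity.Theorems.CertifiedBlowupAxisymBlowup.CompactAmplification

open Literature.Analysis.FluidPDE

section Witness

variable {ν T : ℝ} {u : ℝ → EuclideanSpace ℝ (Fin 3) → EuclideanSpace ℝ (Fin 3)}
  {p : ℝ → EuclideanSpace ℝ (Fin 3) → ℝ}

/-- The hypotheses of the crux's class form the tree's standing hypotheses `AxisymmetricL3Hyp`
(classical on `[0, T)`, Leray–Hopf, bounded on closed sub-slabs, axisymmetric slices; no Type I
field): the two non-literal fields come from `bounded_before_of_lerayHopf_classical` and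
`isAxisymmetric_slice_of_lerayHopf_classical`. [folklore] -/
theorem axisymmetricL3Hyp_of_lerayHopf_classical (hν : 0 < ν) (hT : 0 < T)
    (hcl : IsClassicalNSSolutionOn (Ico 0 T) ν 0 u p) (hLH : IsLerayHopfOn T ν 0 (u 0) u)
    (hdec : HasRapidSpatialDecay (u 0)) (haxi : IsAxisymmetric (u 0)) : AxisymmetricL3Hyp ν T u p :=
  ⟨hν, hT, hcl, hLH, bounded_before_of_lerayHopf_classical hν hcl hLH hdec haxi,
    isAxisymmetric_slice_of_lerayHopf_classical hν hcl hLH hdec haxi⟩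

/-! ### Local boundedness at the final time is an open, co-bounded condition -/

/-- **Local boundedness at the final time is an open condition in the base point**: if `u` is
bounded on `(T - r², T) × B(x₀, r)` then it is bounded on `(T - (r/2)², T) × B(x₁, r/2)` for every
`x₁ ∈ B(x₀, r/2)`. [folklore] -/
theorem isOpen_setOf_isBoundedNearTop (u : ℝ → EuclideanSpace ℝ (Fin 3) → EuclideanSpace ℝ (Fin 3))
    (T : ℝ) : IsOpen {x₀ : EuclideanSpace ℝ (Fin 3) | IsBoundedNearTop u T x₀} := by
  rw [Metric.isOpen_iff]
  rintro x₀ ⟨r, hr, K, hK⟩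
  refine ⟨r / 2, by positivity, fun x₁ hx₁ => ⟨r / 2, by positivity, K, fun t ht x hx => hK t ?_ x ?_⟩⟩
  · exact ⟨lt_of_le_of_lt (by nlinarith) ht.1, ht.2⟩
  · rw [mem_ball] at hx hx₁ ⊢
    calc dist x x₀ ≤ dist x x₁ + dist x₁ x₀ := dist_triangle _ _ _
      _ < r / 2 + r / 2 := add_lt_add hx hx₁
      _ = r := by ring

/-- The blow-up set `{x₀ | ¬ IsBoundedNearTop u T x₀}` is closed. [folklore] -/
theorem isClosed_setOf_not_isBoundedNearTop
    (u : ℝ → EuclideanSpace ℝ (Fin 3) → EuclideanSpace ℝ (Fin 3)) (T : ℝ) :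
    IsClosed {x₀ : EuclideanSpace ℝ (Fin 3) | ¬ IsBoundedNearTop u T x₀} := by
  rw [← isOpen_compl_iff]
  convert isOpen_setOf_isBoundedNearTop u T using 1
  ext x
  simp

/-- **The blow-up set is bounded**: a classical Leray–Hopf solution from a rapidly decaying
axisymmetric datum is bounded near `T` outside a large ball (`axisymmetricL3_boundedNearTop_infinity`:
ε-regularity on the tails of the energy class), hence locally bounded at `(T, x₀)` for every `x₀`
beyond that ball. [cite: RobinsonRodrigoSadowski2016, Lemma 15.12] -/
theorem exists_isBoundedNearTop_of_norm_gt (hν : 0 < ν) (hT : 0 < T)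
    (hcl : IsClassicalNSSolutionOn (Ico 0 T) ν 0 u p) (hLH : IsLerayHopfOn T ν 0 (u 0) u)
    (hdec : HasRapidSpatialDecay (u 0)) (haxi : IsAxisymmetric (u 0)) :
    ∃ R : ℝ, ∀ x₀ : EuclideanSpace ℝ (Fin 3), R < ‖x₀‖ → IsBoundedNearTop u T x₀ := by
  obtain ⟨R, r, K, hr, hK⟩ := axisymmetricL3_boundedNearTop_infinity
    (axisymmetricL3Hyp_of_lerayHopf_classical hν hT hcl hLH hdec haxi)
  refine ⟨R, fun x₀ hx₀ => ?_⟩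
  set ρ : ℝ := min r (‖x₀‖ - R) with hρ_def
  have hρ0 : 0 < ρ := lt_min hr (sub_pos.2 hx₀)
  have hρr : ρ ≤ r := min_le_left _ _
  refine ⟨ρ, hρ0, K, fun t ht x hx => hK t ⟨lt_of_le_of_lt ?_ ht.1, ht.2⟩ x ?_⟩
  · nlinarith [hρ0.le, hρr]
  · rw [mem_ball] at hx
    have h1 : ‖x₀‖ - ‖x‖ ≤ dist x x₀ := by
      rw [dist_eq_norm]
      have := norm_sub_norm_le x₀ x
      rw [← norm_neg (x₀ - x), neg_sub] at this
      linarith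
    have h2 : ρ ≤ ‖x₀‖ - R := min_le_right _ _
    linarith

/-- **The blow-up set lies on the axis** (contrapositive of the landed off-axis regularity
`isBoundedNearTop_of_cylRadius_ne_zero`; Seregin–Šverák 2009, §3: "all singular points must belong
to the axis of symmetry"). [cite: SereginSverak2009, §3 (arXiv p. 9)] -/
theorem cylRadius_eq_zero_of_not_isBoundedNearTop (hν : 0 < ν) (hT : 0 < T)
    (hcl : IsClassicalNSSolutionOn (Ico 0 T) ν 0 u p) (hLH : IsLerayHopfOn T ν 0 (u 0) u)
    (hdec : HasRapidSpatialDecay (u 0)) (haxi : IsAxisymmetric (u 0))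
    {x₀ : EuclideanSpace ℝ (Fin 3)} (hx₀ : ¬ IsBoundedNearTop u T x₀) : cylRadius x₀ = 0 := by
  by_contra h
  exact hx₀ (axisymmetricL3_boundedNearTop_offAxis
    (axisymmetricL3Hyp_of_lerayHopf_classical hν hT hcl hLH hdec haxi) x₀ h)

/-! ### The blow-up set of a witness is nonempty -/

/-- **If every point is a point of local boundedness at `T`, the solution is bounded near `T`**:
a finite subcover of the closed ball of radius `R` (beyond which `u` is bounded near `T`) gives a
uniform bound on a final slab `(T - δ², T) × ℝ³`. [folklore] -/
theorem exists_bound_near_top_of_forall_isBoundedNearTop (hν : 0 < ν) (hT : 0 < T)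
    (hcl : IsClassicalNSSolutionOn (Ico 0 T) ν 0 u p) (hLH : IsLerayHopfOn T ν 0 (u 0) u)
    (hdec : HasRapidSpatialDecay (u 0)) (haxi : IsAxisymmetric (u 0))
    (hall : ∀ x₀ : EuclideanSpace ℝ (Fin 3), IsBoundedNearTop u T x₀) :
    ∃ δ : ℝ, 0 < δ ∧ ∃ K : ℝ, ∀ t ∈ Ioo (T - δ ^ 2) T, ∀ x, ‖u t x‖ ≤ K := by
  classical
  obtain ⟨R, r, K, hr, hK⟩ := axisymmetricL3_boundedNearTop_infinity
    (axisymmetricL3Hyp_of_lerayHopf_classical hν hT hcl hLH hdec haxi)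
  -- radii and bounds at every point
  choose ρ hρ L hL using hall
  -- finite subcover of the closed ball of radius `max R 0`
  set S : Set (EuclideanSpace ℝ (Fin 3)) := closedBall 0 (max R 0) with hS_def
  have hS : IsCompact S := isCompact_closedBall _ _
  obtain ⟨F, -, hcover⟩ := hS.elim_nhds_subcover (fun x => ball x (ρ x))
    (fun x _ => ball_mem_nhds x (hρ x))
  have h0S : (0 : EuclideanSpace ℝ (Fin 3)) ∈ S := mem_closedBall_self (le_max_right _ _)
  have hFne : F.Nonempty := by
    by_contra h
    rw [Finset.not_nonempty_iff_eq_empty] at h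
    have := hcover h0S
    simp [h] at this
  set δ : ℝ := min r (F.inf' hFne ρ) with hδ_def
  have hδ0 : 0 < δ := lt_min hr ((Finset.lt_inf'_iff hFne).2 fun i _ => hρ i)
  have hδr : δ ≤ r := min_le_left _ _
  have hδρ : ∀ i ∈ F, δ ≤ ρ i := fun i hi => (min_le_right _ _).trans (Finset.inf'_le ρ hi)
  set M : ℝ := max K (F.sup' hFne L) with hM_def
  refine ⟨δ, hδ0, M, fun t ht x => ?_⟩
  by_cases hx : R ≤ ‖x‖
  · have ht' : t ∈ Ioo (T - r ^ 2) T := ⟨lt_of_le_of_lt (by nlinarith [hδ0.le, hδr]) ht.1, ht.2⟩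
    exact (hK t ht' x hx).trans (le_max_left _ _)
  · have hxS : x ∈ S := by
      rw [hS_def, mem_closedBall, dist_zero_right]
      exact (not_le.1 hx).le.trans (le_max_left _ _)
    have hxU := hcover hxS
    simp only [mem_iUnion, exists_prop] at hxU
    obtain ⟨i, hiF, hxi⟩ := hxU
    have hδi := hδρ i hiF
    have ht' : t ∈ Ioo (T - ρ i ^ 2) T := ⟨lt_of_le_of_lt (by nlinarith [hδ0.le, hδi]) ht.1, ht.2⟩
    exact (hL i t ht' x hxi).trans ((Finset.le_sup' L hiF).trans (le_max_right _ _))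

/-- **The blow-up set of a witness is nonempty.** A maximal Leray–Hopf classical solution of finite
lifespan `T` from a rapidly decaying axisymmetric datum has a point `x₀` with `u` unbounded on
every backward parabolic neighbourhood of `(T, x₀)`: otherwise `u` would be bounded on a final slab
(`exists_bound_near_top_of_forall_isBoundedNearTop`) and on the complementary closed sub-slab
(`bounded_before_of_lerayHopf_classical`), hence on `[0, T) × ℝ³`, and bounded Leray–Hopf classical
solutions continue past `T` (`hasSmoothExtensionPast_of_bounded_holds`, RRS 2016 Thm 8.17),
contradicting maximality. [cite: RobinsonRodrigoSadowski2016, Thm. 8.17] -/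
theorem exists_not_isBoundedNearTop_of_isMaximalSmoothSolution (hν : 0 < ν) (hT : 0 < T)
    (hmax : IsMaximalSmoothSolution ν 0 u p T) (hLH : IsLerayHopfOn T ν 0 (u 0) u)
    (hdec : HasRapidSpatialDecay (u 0)) (haxi : IsAxisymmetric (u 0)) :
    ∃ x₀ : EuclideanSpace ℝ (Fin 3), ¬ IsBoundedNearTop u T x₀ := by
  by_contra hne
  push Not at hne
  obtain ⟨δ, hδ0, K, hK⟩ :=
    exists_bound_near_top_of_forall_isBoundedNearTop hν hT hmax.1 hLH hdec haxi hne
  -- the earlier slab `[0, T - δ²/2]`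
  set T₁ : ℝ := T - δ ^ 2 / 2 with hT₁_def
  have hT₁T : T₁ < T := by rw [hT₁_def]; nlinarith
  obtain ⟨M, hM⟩ := bounded_before_of_lerayHopf_classical hν hmax.1 hLH hdec haxi T₁ hT₁T
  refine hmax.2 (hasSmoothExtensionPast_of_bounded_holds hν hT hmax.1 hLH ⟨max M K, fun t ht x => ?_⟩)
  rcases le_or_gt t T₁ with h | h
  · exact (hM t ⟨ht.1, h⟩ x).trans (le_max_left _ _)
  · have ht' : t ∈ Ioo (T - δ ^ 2) T := ⟨by rw [hT₁_def] at h; nlinarith, ht.2⟩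
    exact (hK t ht' x).trans (le_max_right _ _)

/-- **The blow-up set of a witness is compact** (closed and bounded in `ℝ³`). [folklore] -/
theorem isCompact_blowupSet_of_lerayHopf_classical (hν : 0 < ν) (hT : 0 < T)
    (hcl : IsClassicalNSSolutionOn (Ico 0 T) ν 0 u p) (hLH : IsLerayHopfOn T ν 0 (u 0) u)
    (hdec : HasRapidSpatialDecay (u 0)) (haxi : IsAxisymmetric (u 0)) :
    IsCompact {x₀ : EuclideanSpace ℝ (Fin 3) | ¬ IsBoundedNearTop u T x₀} := by
  obtain ⟨R, hR⟩ := exists_isBoundedNearTop_of_norm_gt hν hT hcl hLH hdec haxi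
  refine (isCompact_closedBall (0 : EuclideanSpace ℝ (Fin 3)) R).of_isClosed_subset
    (isClosed_setOf_not_isBoundedNearTop u T) fun x₀ hx₀ => ?_
  rw [mem_closedBall, dist_zero_right]
  by_contra h
  exact hx₀ (hR x₀ (not_le.1 h))

end Witness

/-- **The blow-up set of every witness of the crux is a nonempty compact subset of the symmetry
axis** (registered stub of stmt-NavierStokesRegularity-0727): for a maximal Leray–Hopf classical
solution `(u, p)` of finite lifespan `T` from a rapidly decaying axisymmetric datum, the set
`Σ = {x₀ | ¬ IsBoundedNearTop u T x₀}` of points at which `u` is unbounded on every backward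
parabolic neighbourhood of `(T, x₀)` is nonempty, contained in the axis `{cylRadius = 0}`, bounded,
and closed. On the axis the swirl `Γ = r u_θ` vanishes identically. [cite: SereginSverak2009, §3 (arXiv p. 9)] -/
theorem blowupSet_nonempty_compact_on_axis : ∀ {ν T : ℝ} {u : ℝ → EuclideanSpace ℝ (Fin 3) → EuclideanSpace ℝ (Fin 3)} {p : ℝ → EuclideanSpace ℝ (Fin 3) → ℝ}, 0 < ν → 0 < T → IsMaximalSmoothSolution ν 0 u p T → IsLerayHopfOn T ν 0 (u 0) u → HasRapidSpatialDecay (u 0) → IsAxisymmetric (u 0) → (∃ x₀, ¬ IsBoundedNearTop u T x₀) ∧ (∀ x₀, ¬ IsBoundedNearTop u T x₀ → cylRadius x₀ = 0) ∧ (∃ R : ℝ, ∀ x₀, ¬ IsBoundedNearTop u T x₀ → ‖x₀‖ ≤ R) ∧ IsClosed {x₀ | ¬ IsBoundedNearTop u T x₀} := by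
  intro ν T u p hν hT hmax hLH hdec haxi
  refine ⟨exists_not_isBoundedNearTop_of_isMaximalSmoothSolution hν hT hmax hLH hdec haxi,
    fun x₀ hx₀ => cylRadius_eq_zero_of_not_isBoundedNearTop hν hT hmax.1 hLH hdec haxi hx₀, ?_,
    isClosed_setOf_not_isBoundedNearTop u T⟩
  obtain ⟨R, hR⟩ := exists_isBoundedNearTop_of_norm_gt hν hT hmax.1 hLH hdec haxi
  exact ⟨R, fun x₀ hx₀ => not_lt.1 fun h => hx₀ (hR x₀ h)⟩

/-- **Compactness form.** The blow-up set of a witness is a nonempty compact subset of the axis.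
[cite: SereginSverak2009, §3 (arXiv p. 9)] -/
theorem isCompact_blowupSet_of_isMaximalSmoothSolution {ν T : ℝ}
    {u : ℝ → EuclideanSpace ℝ (Fin 3) → EuclideanSpace ℝ (Fin 3)} {p : ℝ → EuclideanSpace ℝ (Fin 3) → ℝ}
    (hν : 0 < ν) (hT : 0 < T) (hmax : IsMaximalSmoothSolution ν 0 u p T)
    (hLH : IsLerayHopfOn T ν 0 (u 0) u) (hdec : HasRapidSpatialDecay (u 0))
    (haxi : IsAxisymmetric (u 0)) :
    IsCompact {x₀ : EuclideanSpace ℝ (Fin 3) | ¬ IsBoundedNearTop u T x₀} ∧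
      {x₀ : EuclideanSpace ℝ (Fin 3) | ¬ IsBoundedNearTop u T x₀}.Nonempty ∧
      {x₀ : EuclideanSpace ℝ (Fin 3) | ¬ IsBoundedNearTop u T x₀} ⊆ {x₀ | cylRadius x₀ = 0} :=
  ⟨isCompact_blowupSet_of_lerayHopf_classical hν hT hmax.1 hLH hdec haxi,
    exists_not_isBoundedNearTop_of_isMaximalSmoothSolution hν hT hmax hLH hdec haxi,
    fun _ hx₀ => cylRadius_eq_zero_of_not_isBoundedNearTop hν hT hmax.1 hLH hdec haxi hx₀⟩

end Summit.NavierStokesRegularity.NavierStokesRegularity.Theorems.CertifiedBlowupAxisymBlowup.CompactAmplification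

end
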